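import Literature.AlgebraicGeometry.Morphisms.ProperCoherentCohomologyFinite
import Literature.AlgebraicGeometry.Morphisms.FormalFunctionsModuleComplete
import Literature.AlgebraicGeometry.Modules.ExtCohomologyComparison
import Mathlib.Algebra.Homology.DerivedCategory.Ext.Linear
import HarnessLib

/-!
# The `Ext` form of «coherent cohomology of a proper scheme over a field is finite-dimensional»,
# and its degree-zero case (Görtz–Wedhorn II, Cor. 23.18 for `i = 0`)

Companion of `Morphisms/ProperCoherentCohomologyFinite`, whose NAMED FACT
`GortzWedhorn2023_cohomology_proper_coherent_finite` (Görtz–Wedhorn II, Cor. 23.18 with `R = k` a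
field; EGA III 3.2.1) is stated on the carrier
`Hom_{D(Mod 𝒪_X)}(Q 𝒪_X[0], (Q 𝓕[0])⟦n⟧)` of Mathlib's derived category of `X.Modules` (at
`HasDerivedCategory.standard`), a `k`-module through `Linear k X.left.Modules`
(`Modules/LinearOverBase`) and Mathlib's `Linear k (DerivedCategory _)`.

* `extUnitLinearEquivCarrier` — that carrier IS Mathlib's `Extⁿ_{𝒪_X}(𝒪_X, 𝓕)` as a `k`-module:
  `Ext (unitModule X) 𝓕 n ≃ₗ[k] Hom_D(Q 𝒪_X[0], (Q 𝓕[0])⟦n⟧)` (Mathlib `Ext.homLinearEquiv`; the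
  objects agree definitionally, `DerivedCategory.singleFunctorIsoCompQ = Iso.refl`);
* `GortzWedhorn2023_cohomology_proper_coherent_finite_iff_ext` — hence the named fact is
  EQUIVALENT to its `Ext` form: for every field `k`, every proper `X → Spec k`, every coherent `𝓕`
  and every `n`, `Extⁿ_{𝒪_X}(𝒪_X, 𝓕)` is a finite `k`-module (`…_of_ext` is the direction a
  discharge will use);
* `extZeroLinearMapSections` — `Ext⁰(𝒪_X, 𝓕) → Γ(X, 𝓕)`, `x ↦ x(1)`, is `k`-linear and injective
  (`Hom(𝒪_X, 𝓕) ↪ Γ(X, 𝓕)`, `Modules/ExtCohomologyComparison.app_top_one_injective`), where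
  `Γ(X, 𝓕) = MSections X.hom 𝓕 ⊤` carries the `k`-module structure through `k → Γ(X, 𝒪_X)`;
* `module_finite_ext_unit_zero` — **degree `0` over a noetherian base ring**: for `X → Spec A`
  proper, `A` noetherian and `𝓕` coherent, `Ext⁰_{𝒪_X}(𝒪_X, 𝓕)` is a finite `A`-module, from the
  tree's finiteness of `Γ(X, 𝓕)` (`FormalFunctionsModuleComplete.moduleFinite_msections_of_coh`,
  Görtz–Wedhorn II Thm. 23.17 for `i = 0`, proved there by dévissage and Chow's lemma);
* `GortzWedhorn2023_cohomology_proper_coherent_finite_degree_zero` — **the named fact in degree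
  `n = 0`, PROVED verbatim on its own carrier** (every field `k`, every proper `X`, every coherent
  `𝓕`).

The named fact itself (all `n`) is NOT discharged here: for `n ≥ 1` the tree lacks the comparison of
the derived carrier with a Čech complex in all degrees (Görtz–Wedhorn II Thm. 22.9 / Hartshorne III
Thm. 4.5) — see the unit's notes. Nothing in this file bears on any summit statement.

## References

* U. Görtz, T. Wedhorn, *Algebraic Geometry II: Cohomology of Schemes*, Springer Spektrum (2023),
  doi:10.1007/978-3-658-43031-3: Thm. 23.17 (p. 424), Cor. 23.18 (p. 425). [GortzWedhorn2023]
* R. Hartshorne, *Algebraic Geometry*, GTM 52 (1977), III Prop. 6.3 (c) (`Ext⁰(𝒪_X, 𝓕) = Γ(X, 𝓕)`),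
  III Thm. 5.2 (a). [Hartshorne1977]
-/

noncomputable section

open CategoryTheory CategoryTheory.Abelian AlgebraicGeometry Opposite

universe w

namespace Literature.AlgebraicGeometry.Morphisms

open Literature.AlgebraicGeometry.Modules

section Carrier

variable {k : Type} [CommRing k] (X : Over (Spec (CommRingCat.of k))) (F : X.left.Modules)

/-- **The carrier of the named fact is `Extⁿ_{𝒪_X}(𝒪_X, 𝓕)`**: Mathlib's `k`-linear equivalence
`Ext.homLinearEquiv` between `Ext (unitModule X) 𝓕 n` (any `Ext`-universe) and the morphisms
`Q 𝒪_X[0] → (Q 𝓕[0])⟦n⟧` in the standard derived category of `X.Modules`.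
[cite: Hartshorne1977, III Prop. 6.3 (c)] -/
def extUnitLinearEquivCarrier [HasExt.{w} X.left.Modules] (n : ℕ) :
    letI := HasDerivedCategory.standard X.left.Modules
    Ext.{w} (unitModule X.left) F n ≃ₗ[k]
      ShiftedHom
        (DerivedCategory.Q.obj ((HomologicalComplex.single X.left.Modules (ComplexShape.up ℤ) 0).obj
          (unitModule X.left)))
        (DerivedCategory.Q.obj ((HomologicalComplex.single X.left.Modules (ComplexShape.up ℤ) 0).obj F))
        (n : ℤ) :=
  letI := HasDerivedCategory.standard X.left.Modules
  Ext.homLinearEquiv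

end Carrier

/-- **The named fact follows from its `Ext` form** (finiteness of `Extⁿ_{𝒪_X}(𝒪_X, 𝓕)` over `k`
for all proper `X → Spec k`, coherent `𝓕`, `n`). [cite: GortzWedhorn2023, Cor. 23.18 (p. 425)] -/
theorem GortzWedhorn2023_cohomology_proper_coherent_finite_of_ext
    (h : ∀ (k : Type) [Field k] (X : Over (Spec (CommRingCat.of k))) [IsProper X.hom]
      (F : X.left.Modules), Coh F → ∀ n : ℕ, Module.Finite k (Ext.{1} (unitModule X.left) F n)) :
    GortzWedhorn2023_cohomology_proper_coherent_finite := by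
  intro k _ X _ F hF n
  letI := HasDerivedCategory.standard X.left.Modules
  haveI := h k X F hF n
  exact Module.Finite.equiv (extUnitLinearEquivCarrier.{1} X F n)

/-- **The named fact is equivalent to its `Ext` form.** [cite: GortzWedhorn2023, Cor. 23.18 (p. 425)] -/
theorem GortzWedhorn2023_cohomology_proper_coherent_finite_iff_ext :
    GortzWedhorn2023_cohomology_proper_coherent_finite ↔
      ∀ (k : Type) [Field k] (X : Over (Spec (CommRingCat.of k))) [IsProper X.hom]
        (F : X.left.Modules), Coh F → ∀ n : ℕ, Module.Finite k (Ext.{1} (unitModule X.left) F n) := by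
  refine ⟨fun h k _ X _ F hF n => ?_, GortzWedhorn2023_cohomology_proper_coherent_finite_of_ext⟩
  letI := HasDerivedCategory.standard X.left.Modules
  haveI := h k X F hF n
  exact Module.Finite.equiv (extUnitLinearEquivCarrier.{1} X F n).symm

/-! ## Degree zero: `Ext⁰(𝒪_X, 𝓕) ↪ Γ(X, 𝓕)`, `k`-linearly -/

section DegreeZero

variable {k : Type} [CommRing k] (X : Over (Spec (CommRingCat.of k))) (F : X.left.Modules)

/-- Evaluation at the unit section, `Hom_{𝒪_X}(𝒪_X, 𝓕) → Γ(X, 𝓕)`, `φ ↦ φ_X(1)`, as a `k`-linear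
map to `Γ(X, 𝓕)` with its `k`-module structure through `k → Γ(X, 𝒪_X)` (`MSections X.hom 𝓕 ⊤`).
[cite: Hartshorne1977, III Prop. 6.3 (c)] -/
def homUnitLinearMapSections : (unitModule X.left ⟶ F) →ₗ[k] MSections X.hom F ⊤ where
  toFun φ := φ.app ⊤ (1 : X.left.presheaf.obj (op ⊤))
  map_add' φ ψ := by
    change (φ + ψ).app ⊤ (1 : X.left.presheaf.obj (op ⊤)) =
      φ.app ⊤ (1 : X.left.presheaf.obj (op ⊤)) + ψ.app ⊤ (1 : X.left.presheaf.obj (op ⊤))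
    rw [Scheme.Modules.Hom.add_app]
    rfl
  map_smul' c φ := by
    dsimp only [RingHom.id_apply]
    rw [base_smul_app_apply]
    rfl

/-- `φ ↦ φ_X(1)` is injective (a morphism out of `𝒪_X` is determined by the image of `1`).
[cite: Hartshorne1977, III Prop. 6.3 (c)] -/
theorem homUnitLinearMapSections_injective : Function.Injective (homUnitLinearMapSections X F) :=
  app_top_one_injective F

variable [HasExt.{w} X.left.Modules]

/-- **`Ext⁰_{𝒪_X}(𝒪_X, 𝓕) → Γ(X, 𝓕)`**, `x ↦ x(1)` (through Mathlib's `Ext.linearEquiv₀ : Ext⁰ ≃ Hom`),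
`k`-linear. [cite: Hartshorne1977, III Prop. 6.3 (c)] -/
def extZeroLinearMapSections : Ext.{w} (unitModule X.left) F 0 →ₗ[k] MSections X.hom F ⊤ :=
  (homUnitLinearMapSections X F).comp (Ext.linearEquiv₀ (R := k)).toLinearMap

/-- `extZeroLinearMapSections` is injective. [cite: Hartshorne1977, III Prop. 6.3 (c)] -/
theorem extZeroLinearMapSections_injective : Function.Injective (extZeroLinearMapSections.{w} X F) :=
  (homUnitLinearMapSections_injective X F).comp (Ext.linearEquiv₀ (R := k)).injective

/-- **Degree `0` over a noetherian ring**: for `X → Spec A` proper over a noetherian ring `A` and `𝓕`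
coherent, `Ext⁰_{𝒪_X}(𝒪_X, 𝓕)` is a finite `A`-module — it embeds `A`-linearly into `Γ(X, 𝓕)`, which
is finite (Görtz–Wedhorn II Thm. 23.17, `i = 0`, the tree's `moduleFinite_msections_of_coh`).
[cite: GortzWedhorn2023, Thm. 23.17 (p. 424)] -/
theorem module_finite_ext_unit_zero [IsNoetherianRing k] [IsProper X.hom] (hF : Coh F) :
    Module.Finite k (Ext.{w} (unitModule X.left) F 0) := by
  haveI : Module.Finite k (MSections X.hom F ⊤) := moduleFinite_msections_of_coh X.hom hF
  exact Module.Finite.of_injective (extZeroLinearMapSections.{w} X F)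
    (extZeroLinearMapSections_injective.{w} X F)

end DegreeZero

/-- **The named fact in degree `0`, proved**: for every field `k`, every proper `X → Spec k` and every
coherent `𝒪_X`-module `𝓕`, the `k`-module `Hom_{D(Mod 𝒪_X)}(Q 𝒪_X[0], (Q 𝓕[0])⟦0⟧) = Ext⁰(𝒪_X, 𝓕) =
Γ(X, 𝓕)` is finite-dimensional (Görtz–Wedhorn II Cor. 23.18, `i = 0`). This is the instance `n = 0`
of `GortzWedhorn2023_cohomology_proper_coherent_finite`, verbatim.
[cite: GortzWedhorn2023, Cor. 23.18 (p. 425)] -/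
theorem GortzWedhorn2023_cohomology_proper_coherent_finite_degree_zero (k : Type) [Field k]
    (X : Over (Spec (CommRingCat.of k))) [IsProper X.hom] (F : X.left.Modules) (hF : Coh F) :
    letI := HasDerivedCategory.standard X.left.Modules
    Module.Finite k
      (ShiftedHom
        (DerivedCategory.Q.obj ((HomologicalComplex.single X.left.Modules (ComplexShape.up ℤ) 0).obj
          (unitModule X.left)))
        (DerivedCategory.Q.obj ((HomologicalComplex.single X.left.Modules (ComplexShape.up ℤ) 0).obj F))
        ((0 : ℕ) : ℤ)) := by
  letI := HasDerivedCategory.standard X.left.Modules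
  haveI := module_finite_ext_unit_zero.{1} X F hF
  exact Module.Finite.equiv (extUnitLinearEquivCarrier.{1} X F 0)

end Literature.AlgebraicGeometry.Morphisms

end
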